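import Summits.QuantumFields.YangMills.Theorems.ColdStartUniversalityShenZhuZhuHaarCeilingSUN
import Summits.QuantumFields.YangMills.Theorems.ColdStartUniversalityLatticeLangevinWilsonLogSobolevPoincare
import HarnessLib

/-!
# LOG-SOBOLEV ⇒ POINCARÉ in the Bakry–Émery Γ-currency for every `SU(N)`, `d`, coupling and volume (Bakry–Gentil–Ledoux Prop. 5.1.3), and the
# HAAR CEILING FOR THE LOG-SOBOLEV CONSTANT: `K_LS ≤ (N² − 1)/N` at every coupling

Seat `ym-line-csu-p1` (g40), route `ColdStartUniversality` of `Summits/QuantumFields/YangMills`, helper file G35 (`--supports stmt-QuantumFields-24809`).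
In SZZ's normalisation (CMP 400 (2023) (4.12)–(4.13)) a constant `K` is a LOG-SOBOLEV constant of the torus Wilson measure `μ_{Λ_L,β'}` if
`K·Ent_μ(u²) ≤ 2∫Γ(u,u) dμ` for every smooth `u` of the link matrices, and a POINCARÉ constant if `K·Var_μ(u) ≤ ∫Γ(u,u) dμ`.  g21 proved
«LSI(ρ) ⇒ Poincaré» for the `SU(2)`, `d = 3` dynamics in semigroup / generator form; here the STATIC Γ-form for every `SU(N)`, `d`:

* §1 `Gam_one_add_smul` — `Γ(1 + ε(u − m)) = ε²Γ(u)`; ★★ `poincare_of_logSobolev_Gam_sun` — every log-Sobolev constant is a Poincaré constant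
  (apply the LSI to `1 + ε(u − μu)`; `Ent_μ((1+εg)²) ≥ 2ε²Var − O(ε³)` is g21's abstract `entropy_sq_one_add_smul_ge`; let `ε ↓ 0`).
* §2 ★★★ `logSobolevConst_le_haarCeiling_sun` — THE CEILING: every log-Sobolev constant of `μ_{Λ_L,β'}` (`N ≥ 2`, `L ≥ 2`, any `β'`, any `d`) is
  `≤ N − 1/N` (G33's Haar ceiling for Poincaré constants); so the optimal log-Sobolev constant at strong coupling lies in `[N/2 − 4dN|β|·?, N − 1/N]`
  — the lower end is the venture/seat Bakry–Émery LSI where available (`SU(2)`, `d = 3`: `1 − 12|β'|`, g26), NOT proved here for general `(N, d)`.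

THEOREMS ONLY, no definition, no sorry.  HONEST FRAMING: fixed-lattice structural facts; no log-Sobolev inequality is PROVED here for general
`(N, d)` (only the implication and the ceiling); nothing `K`-uniform along the route's scaling (`UniformColdStartMixing`, 24809, ASIDE, not restated);
no crux, rung or summit statement is proved; the Yang–Mills mass gap is NOT proved.  References: D. Bakry, I. Gentil, M. Ledoux, Grundlehren 348
(2014), Prop. 5.1.3 [BakryGentilLedoux2014]; H. Shen, R. Zhu, X. Zhu, CMP 400 (2023) (4.12)–(4.13) [ShenZhuZhu2022]; S. Elitzur, Phys. Rev. D 12 (1975).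
-/

set_option autoImplicit false

noncomputable section

namespace Summit.QuantumFields.YangMills.Theorems.ColdStartUniversality

open MeasureTheory ProbabilityTheory Finset Filter Set Function
open scoped BigOperators NNReal ENNReal Topology Matrix Matrix.Norms.Frobenius ContDiff
open Literature.MathematicalPhysics.QuantumFieldTheory
open Literature.MathematicalPhysics.QuantumLattice (fundamentalRep continuous_fundamentalRep fundamentalRep_apply)
open Literature.MathematicalPhysics.QuantumFieldTheory.SUNBakryEmery (SUN FrameIdx)
open Summit.Ventures.YMGap.LatticeBakryEmery (PSU Cfg emb emb_apply Gam lk bframe algD algD_apply algD_const algD_const_mul algD_sub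
  linkFun linkFun_apply Gam_self_eq_sum_linkFun Gam_self_nonneg contDiff_Gam contDiff_algD continuous_emb continuous_restrict)

variable {d N L : ℕ} [NeZero L]

/-! ## §1. Log-Sobolev ⇒ Poincaré (static Γ-form, BGL Prop. 5.1.3) -/

/-- **`Γ(1 + ε(u − m)) = ε² Γ(u)`**: the carré du champ is quadratic and kills constants. [cite: BakryGentilLedoux2014, Prop. 5.1.3 (proof)] -/
theorem Gam_one_add_smul {ι : Type} [Fintype ι] [DecidableEq ι] {u : Cfg ι N → ℝ} (hu : ContDiff ℝ ∞ u) (m ε : ℝ) (Q : Cfg ι N) :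
    Gam (fun Q => 1 + ε * (u Q - m)) (fun Q => 1 + ε * (u Q - m)) Q = ε ^ 2 * Gam u u Q := by
  have hum : ContDiff ℝ ∞ (fun Q : Cfg ι N => u Q - m) := hu.sub contDiff_const
  have hεum : ContDiff ℝ ∞ (fun Q : Cfg ι N => ε * (u Q - m)) := contDiff_const.mul hum
  have hD : ∀ A : Cfg ι N, algD A (fun Q => 1 + ε * (u Q - m)) Q = ε * algD A u Q := by
    intro A
    have h1 : (fun Q : Cfg ι N => 1 + ε * (u Q - m)) = (fun _ : Cfg ι N => (1 : ℝ)) + fun Q => ε * (u Q - m) := by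
      funext Q; simp
    have h2 : (fun Q : Cfg ι N => u Q - m) = u - fun _ => m := by funext Q; simp
    rw [h1, Summit.Ventures.YMGap.LatticeBakryEmery.algD_add contDiff_const hεum, algD_const, algD_const_mul hum, h2,
      algD_sub hu contDiff_const, algD_const]
    simp
  rw [Gam_self_eq_sum_linkFun, Gam_self_eq_sum_linkFun, Finset.mul_sum]
  refine Finset.sum_congr rfl fun e _ => ?_
  rw [Finset.mul_sum]
  refine Finset.sum_congr rfl fun α _ => ?_
  rw [linkFun_apply, linkFun_apply, hD]
  ring

/-- ★★ **Every log-Sobolev constant is a Poincaré constant** (static Γ-form of Bakry–Gentil–Ledoux Prop. 5.1.3), every `SU(N)` (`N ≥ 1`), `d`,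
torus, coupling: if `K·Ent_{μ_{Λ_L,β'}}(u²) ≤ 2∫Γ(u,u) dμ_{Λ_L,β'}` for every smooth `u` of the link matrices, then
`K·Var_{μ_{Λ_L,β'}}(u) ≤ ∫Γ(u,u) dμ_{Λ_L,β'}` for every smooth `u` (apply the hypothesis to `1 + ε(u − μu)` and let `ε ↓ 0`).
[cite: BakryGentilLedoux2014, Prop. 5.1.3] -/
theorem poincare_of_logSobolev_Gam_sun (β' : ℝ) {K : ℝ}
    (hLS : ∀ u : Cfg (Edge d L) N → ℝ, ContDiff ℝ ∞ u →
      K * ((∫ U, (u (emb U)) ^ 2 * Real.log ((u (emb U)) ^ 2) ∂(wilsonMeasure (d := d) (L := L) (fundamentalRep (Fin N)) β')) -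
          (∫ U, (u (emb U)) ^ 2 ∂(wilsonMeasure (d := d) (L := L) (fundamentalRep (Fin N)) β')) *
            Real.log (∫ U, (u (emb U)) ^ 2 ∂(wilsonMeasure (d := d) (L := L) (fundamentalRep (Fin N)) β'))) ≤
        2 * ∫ U, Gam u u (emb U) ∂(wilsonMeasure (d := d) (L := L) (fundamentalRep (Fin N)) β'))
    (u : Cfg (Edge d L) N → ℝ) (hu : ContDiff ℝ ∞ u) :
    K * Var[fun U : GaugeConfig d L (SUN N) => u (emb U); wilsonMeasure (d := d) (L := L) (fundamentalRep (Fin N)) β'] ≤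
      ∫ U, Gam u u (emb U) ∂(wilsonMeasure (d := d) (L := L) (fundamentalRep (Fin N)) β') := by
  set μ := wilsonMeasure (d := d) (L := L) (fundamentalRep (Fin N)) β' with hμ
  haveI : IsProbabilityMeasure μ :=
    isProbabilityMeasure_wilsonMeasure (d := d) (L := L) (fundamentalRep (Fin N)) (continuous_fundamentalRep (n := Fin N)) β'
  haveI : SecondCountableTopology (Matrix (Fin N) (Fin N) ℂ) := inferInstanceAs (SecondCountableTopology (Fin N → Fin N → ℂ))
  haveI : SecondCountableTopology (SUN N) := Topology.IsEmbedding.subtypeVal.secondCountableTopology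
  have hI : 0 ≤ ∫ U, Gam u u (emb U) ∂μ := integral_nonneg fun U => Gam_self_nonneg u (emb U)
  -- the centred observable and its bound
  set m : ℝ := ∫ U, u (emb U) ∂μ with hm
  set g : GaugeConfig d L (SUN N) → ℝ := fun U => u (emb U) - m with hg
  have huc : Continuous fun U : GaugeConfig d L (SUN N) => u (emb U) := continuous_restrict hu
  have hgc : Continuous g := huc.sub continuous_const
  have hgm : Measurable g := hgc.measurable
  obtain ⟨M, hM⟩ : ∃ M, ∀ U, |g U| ≤ M := by
    obtain ⟨M, hM⟩ := (isCompact_univ (X := GaugeConfig d L (SUN N))).exists_bound_of_continuousOn hgc.continuousOn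
    exact ⟨M, fun U => by simpa [Real.norm_eq_abs] using hM U (Set.mem_univ _)⟩
  have hM0 : 0 ≤ M := (abs_nonneg _).trans (hM fun _ => 1)
  have hg0 : ∫ U, g U ∂μ = 0 := by
    simp only [hg]
    rw [integral_sub (huc.integrable_of_hasCompactSupport (HasCompactSupport.of_compactSpace _)) (integrable_const m), integral_const, hm]
    simp
  set V : ℝ := ∫ U, g U ^ 2 ∂μ with hV
  have hV0 : 0 ≤ V := integral_nonneg fun U => sq_nonneg _
  have hvar : Var[fun U : GaugeConfig d L (SUN N) => u (emb U); μ] = V := by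
    rw [variance_eq_integral huc.measurable.aemeasurable]
  rw [hvar]
  by_cases hK : K ≤ 0
  · exact (mul_nonpos_of_nonpos_of_nonneg hK hV0).trans hI
  push Not at hK
  -- the family `1 + ε g`
  have key : ∀ ε : ℝ, 0 < ε → ε ≤ 1 → ε * M ≤ 1 / 2 →
      K * (2 * ε ^ 2 * V - ε ^ 3 * (5 * M * V + V ^ 2)) ≤ 2 * (ε ^ 2 * ∫ U, Gam u u (emb U) ∂μ) := by
    intro ε hε hε1 hεM
    have hent := entropy_sq_one_add_smul_ge μ hgm hM hg0 hε.le hε1 hεM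
    have hh : ContDiff ℝ ∞ (fun Q : Cfg (Edge d L) N => 1 + ε * (u Q - m)) := contDiff_const.add (contDiff_const.mul (hu.sub contDiff_const))
    have hls := hLS _ hh
    have hG : ∫ U, Gam (fun Q => 1 + ε * (u Q - m)) (fun Q => 1 + ε * (u Q - m)) (emb U) ∂μ = ε ^ 2 * ∫ U, Gam u u (emb U) ∂μ := by
      rw [← integral_const_mul]
      exact integral_congr_ae (ae_of_all _ fun U => Gam_one_add_smul hu m ε (emb U))
    rw [hG] at hls
    have heq : ∀ U : GaugeConfig d L (SUN N), (1 + ε * (u (emb U) - m)) = 1 + ε * g U := fun U => rfl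
    simp only [heq] at hls
    exact (mul_le_mul_of_nonneg_left hent hK.le).trans hls
  -- let `ε ↓ 0`
  set C : ℝ := 5 * M * V + V ^ 2 with hC
  have hC0 : 0 ≤ C := by positivity
  refine le_of_forall_pos_le_add fun δ hδ => ?_
  -- choose `ε = min (1/(2M+2)) (δ/(K C + 1))`-ish
  obtain ⟨ε, hε, hε1, hεM, hεδ⟩ : ∃ ε : ℝ, 0 < ε ∧ ε ≤ 1 ∧ ε * M ≤ 1 / 2 ∧ ε * (K * C) ≤ δ := by
    refine ⟨min (1 / (2 * M + 2)) (δ / (K * C + 1)), ?_, ?_, ?_, ?_⟩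
    · exact lt_min (by positivity) (by positivity)
    · exact (min_le_left _ _).trans (by rw [div_le_one (by positivity)]; linarith)
    · have h1 : min (1 / (2 * M + 2)) (δ / (K * C + 1)) * M ≤ 1 / (2 * M + 2) * M :=
        mul_le_mul_of_nonneg_right (min_le_left _ _) hM0
      refine h1.trans ?_
      rw [div_mul_eq_mul_div, one_mul, div_le_iff₀ (by positivity)]
      linarith
    · have h1 : min (1 / (2 * M + 2)) (δ / (K * C + 1)) * (K * C) ≤ δ / (K * C + 1) * (K * C) :=
        mul_le_mul_of_nonneg_right (min_le_right _ _) (by positivity)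
      refine h1.trans ?_
      rw [div_mul_eq_mul_div, div_le_iff₀ (by positivity)]
      nlinarith [mul_nonneg hK.le hC0]
  have h := key ε hε hε1 hεM
  -- divide by `2ε²`
  have h2 : K * V - ε * (K * C) / 2 ≤ ∫ U, Gam u u (emb U) ∂μ := by
    have hε2 : 0 < 2 * ε ^ 2 := by positivity
    have : 2 * ε ^ 2 * (K * V - ε * (K * C) / 2) ≤ 2 * ε ^ 2 * ∫ U, Gam u u (emb U) ∂μ := by
      calc 2 * ε ^ 2 * (K * V - ε * (K * C) / 2) = K * (2 * ε ^ 2 * V - ε ^ 3 * C) := by ring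
        _ ≤ 2 * (ε ^ 2 * ∫ U, Gam u u (emb U) ∂μ) := h
        _ = 2 * ε ^ 2 * ∫ U, Gam u u (emb U) ∂μ := by ring
    exact le_of_mul_le_mul_left this hε2
  linarith

/-! ## §2. The Haar ceiling for the log-Sobolev constant -/

/-- ★★★ **THE HAAR CEILING FOR THE LOG-SOBOLEV CONSTANT**: for `N ≥ 2`, every `d`, every torus `(ℤ/L)^d` with `L ≥ 2` (and a link `e₀`), every
coupling `β'`: if `K·Ent_{μ_{Λ_L,β'}}(u²) ≤ 2∫Γ(u,u) dμ_{Λ_L,β'}` for every smooth `u` of the link matrices, then `K ≤ N − 1/N = (N² − 1)/N` —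
Elitzur (single-link marginals are Haar) through G33's Poincaré ceiling and §1.  HONEST FRAMING: an upper bound in lattice units at fixed cut-off;
no log-Sobolev inequality is proved here; no bearing on `K`-uniformity in physical units; the Yang–Mills mass gap is NOT proved.
[cite: Elitzur1975, (local gauge invariance)] -/
theorem logSobolevConst_le_haarCeiling_sun (hN : 2 ≤ N) (hL : 1 < L) (β' : ℝ) (e₀ : Edge d L) {K : ℝ}
    (hLS : ∀ u : Cfg (Edge d L) N → ℝ, ContDiff ℝ ∞ u →
      K * ((∫ U, (u (emb U)) ^ 2 * Real.log ((u (emb U)) ^ 2) ∂(wilsonMeasure (d := d) (L := L) (fundamentalRep (Fin N)) β')) -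
          (∫ U, (u (emb U)) ^ 2 ∂(wilsonMeasure (d := d) (L := L) (fundamentalRep (Fin N)) β')) *
            Real.log (∫ U, (u (emb U)) ^ 2 ∂(wilsonMeasure (d := d) (L := L) (fundamentalRep (Fin N)) β'))) ≤
        2 * ∫ U, Gam u u (emb U) ∂(wilsonMeasure (d := d) (L := L) (fundamentalRep (Fin N)) β')) :
    K ≤ (N : ℝ) - 1 / N :=
  poincareConst_le_haarCeiling_sun hN hL β' e₀ fun u hu => poincare_of_logSobolev_Gam_sun (L := L) β' hLS u hu

end Summit.QuantumFields.YangMills.Theorems.ColdStartUniversality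

end
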